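import Literature.Probability.RandomPlanarGeometry.HexSAWSurfaceWallRenewalSlackTwoClassification
import Literature.Probability.RandomPlanarGeometry.HexSAWSurfaceWallRenewalIteratedGap
import HarnessLib

/-!
# Slack four, four down steps: the order `D D U U D U D U` (hairpin, then two bumps) does not occur

For the self-avoiding walk on the honeycomb lattice (brick-wall frame) in the half-plane `Y ≤ 0`, consider an IRREDUCIBLE
POSITIVE WALL BRIDGE `ω ∈ ipwb m` at SLACK FOUR (`m = 6k + 4`, `k = visits m ω ≥ 2`) with FOUR down steps, in the vertical
profile of `profile_of_card_stepsD_eq_four` (`…FourDownProfile`): down times `p₁ < p₂ < p₃ < p₄`, up times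
`r₁ < r₂ < r₃ < r₄`, the initial wall run `(i, 0)`, `i ≤ p₁`, the first dive at the odd time `p₁`, all other steps horizontal.

* `dduududu_slack_four_false` — the vertical order `p₁ < p₂ < r₁ < r₂ < p₃ < r₃ < p₄ < r₄` (word `D D U U D U D U`: a
  hairpin to depth two, a wall run, a BUMP `D U`, a wall run, a second BUMP) is impossible.

PROOF (near-renewal count, as in `…SlackFourFourDownHairpinBump` / `…DipBump`, with two bumps).  §1 is the run
decomposition of the order (seven monotone body runs on the rows `−1, −2, −1, 0, −1, 0, −1`, `run_const_velocity` of
`…SecondGap`; the rightward final wall run; column parities; positivity) and, separately, the visit count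
`p₁ + p₃ + p₄ + m = r₂ + r₃ + r₄ + 2k + 3` (`visits_add` / `visits_add_eq_left`).  §2, signs by collisions, from the
right end: the last bump goes RIGHT (else the final wall run crosses its dive column); the wall run before it goes RIGHT
(else the walk is back on the wall on that run, or the plateau passes under the end of the first bump); the first bump
goes RIGHT (a left plateau ends at a wall column that the second wall run, the second bump or the final run passes — over
the dive site, under the plateau's start, or over the dive site again); the first wall run goes RIGHT (else the
first bump passes under the hairpin's return site, or the second wall run starts on a site of the first).  Then every
interior near-renewal visit time (`NearRenewal` of `…SixStep`) on a wall run or on the final run is a wall-renewal time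
(`isWRen_of_profile`: everything later lies strictly to its right), an initial-run visit time `t ≥ 4` is not a
near-renewal (`exists_left_step_onto` at the time `2`), so `#E ≤ 1` and `slack_four_counts` (`…IteratedGap`) forces the
span `X = 2k + 2`; but `X = c + (m − r₂ − 5)` with the fresh odd return column `c = X_{r₂} ≥ p₁ + 2` of the hairpin, and
the visit count gives `c = p₁ + p₃ + p₄ + 4 − r₃ − r₄ ≤ p₁` — contradiction.

STATUS: lane theorem of the a-idea-1 bridge/renewal lineage (car 94-E), fifth module of the ORDER EXCLUSION for four down
steps at slack four (FINDING-HEX-WALL-SLACK-FOUR-LAW, the four-down law `12·N = (k − 2)(2k⁴ − 7k³ + 4k² + 7k + 6)`).  OURS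
(routine): checked against the lane's enumeration of all irreducible positive wall bridges at slack four for `k ≤ 8` (no
word `D D U U D U D U` among the `0, 3, 27, 129, 424, 1105, 2463` four-down walks at `k = 2 … 8`).  The printed sources carry
the renewal / irreducible-bridge structure (Madras–Slade §4.2, Definition 4.2.1, remark before (4.2.21), p. 94) and the
brickwork frame of the honeycomb lattice (Enting–Jensen §7.4.2, Fig. 7.10) — none states this fact.
No `set_option maxHeartbeats` line is used.
-/

namespace Literature.Probability.RandomPlanarGeometry.SAW.HexBW.Wall

open Finset Filter Function
open Literature.Probability.LatticeModels Literature.Probability.Percolation SimpleGraph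

variable {ω : ℕ → Site 2}

/-- [folklore] Two coordinates determine a site of `ℤ²`. -/
private theorem site_ext_tb {p q : Site 2} (h0 : p 0 = q 0) (h1 : p 1 = q 1) : p = q := by
  funext k
  fin_cases k
  · exact h0
  · exact h1

/-- [folklore] Slack-four visit numerics, two interior wall runs `(s, q]`, `(s', q']`. -/
private theorem visits_count_tb_w2 {k m p q s q' s' r : ℕ} (hm : m = 6 * k + 4)
    (hv : p / 2 + (q - s) / 2 + (q' - s') / 2 + (m - r) / 2 = k) (hp : p % 2 = 1) (hq : q % 2 = 1) (hs : s % 2 = 0)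
    (hsq : s < q) (hq' : q' % 2 = 1) (hs' : s' % 2 = 0) (hsq' : s' < q') (hr : r % 2 = 0) (hrm : r < m) :
    p + (q + q') + m = (s + s') + r + 2 * k + 3 := by
  omega

/-- **Runs of the order `D D U U D U D U`.** For `m = 6k + 4`, `ω ∈ ipwb m` with `k` visits, four down steps at
`p₁ < p₂ < p₃ < p₄` and four up steps at `r₁ < r₂ < r₃ < r₄` in the order `p₂ < r₁`, `r₂ < p₃ < r₃ < p₄ < r₄`, in the
profile of `profile_of_card_stepsD_eq_four`: the seven monotone body runs (rows `−1, −2, −1, 0, −1, 0, −1`) with their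
signs, the rightward final wall run, the final-run length, the column parities and the positivity of the interior columns.
Same generator as the occurring orders (`…SlackFourFourDownRuns`; the visit count is `dduududu4_visits`, the gaps are
not needed); tool for `dduududu_slack_four_false`.  OURS (routine).
[cite: MadrasSlade1993, §4.2, Definition 4.2.1 (p. 90), (4.2.2); EntingJensen2009, §7.4.2, Fig. 7.10] -/
theorem dduududu4_runs {k m : ℕ} (hm : m = 6 * k + 4) (hω : ω ∈ ipwb m) (hv : visits m ω = k)
    {p₁ p₂ p₃ p₄ r₁ r₂ r₃ r₄ : ℕ} (hD : stepsD m ω = {p₁, p₂, p₃, p₄}) (hU : stepsU m ω = {r₁, r₂, r₃, r₄})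
    (h12 : p₁ < p₂) (h23 : p₂ < p₃) (h34 : p₃ < p₄) (hr12 : r₁ < r₂) (hr23 : r₂ < r₃) (hr34 : r₃ < r₄)
    (ht2 : p₂ < r₁) (ht4 : r₂ < p₃) (ht5 : p₃ < r₃) (ht6 : r₃ < p₄) (ht7 : p₄ < r₄) (hp1 : 1 ≤ p₁)
    (hR0 : ∀ i, i ≤ p₁ → ω i 0 = i ∧ ω i 1 = 0)
    (hP1x : ω (p₁ + 1) 0 = p₁) (hP1y : ω (p₁ + 1) 1 = -1)
    (hhor : ∀ i, i < m → i ∉ stepsD m ω → i ∉ stepsU m ω →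
      ω (i + 1) 1 = ω i 1 ∧ (ω (i + 1) 0 = ω i 0 + 1 ∨ ω (i + 1) 0 = ω i 0 - 1)) :
    ∃ e₁ e₂ e₃ e₄ e₅ e₆ e₇ : ℤ, (e₁ = 1 ∨ e₁ = -1) ∧ (e₂ = 1 ∨ e₂ = -1) ∧ (e₃ = 1 ∨ e₃ = -1) ∧ (e₄ = 1 ∨ e₄ = -1) ∧
      (e₅ = 1 ∨ e₅ = -1) ∧ (e₆ = 1 ∨ e₆ = -1) ∧ (e₇ = 1 ∨ e₇ = -1) ∧
      (∀ i, p₁ + 1 ≤ i → i ≤ p₂ → ω i 0 = p₁ + e₁ * ((i - (p₁ + 1) : ℕ) : ℤ) ∧ ω i 1 = -1) ∧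
      (∀ i, p₂ + 1 ≤ i → i ≤ r₁ → ω i 0 = ω p₂ 0 + e₂ * ((i - (p₂ + 1) : ℕ) : ℤ) ∧ ω i 1 = -2) ∧
      (∀ i, r₁ + 1 ≤ i → i ≤ r₂ → ω i 0 = ω r₁ 0 + e₃ * ((i - (r₁ + 1) : ℕ) : ℤ) ∧ ω i 1 = -1) ∧
      (∀ i, r₂ + 1 ≤ i → i ≤ p₃ → ω i 0 = ω r₂ 0 + e₄ * ((i - (r₂ + 1) : ℕ) : ℤ) ∧ ω i 1 = 0) ∧
      (∀ i, p₃ + 1 ≤ i → i ≤ r₃ → ω i 0 = ω p₃ 0 + e₅ * ((i - (p₃ + 1) : ℕ) : ℤ) ∧ ω i 1 = -1) ∧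
      (∀ i, r₃ + 1 ≤ i → i ≤ p₄ → ω i 0 = ω r₃ 0 + e₆ * ((i - (r₃ + 1) : ℕ) : ℤ) ∧ ω i 1 = 0) ∧
      (∀ i, p₄ + 1 ≤ i → i ≤ r₄ → ω i 0 = ω p₄ 0 + e₇ * ((i - (p₄ + 1) : ℕ) : ℤ) ∧ ω i 1 = -1) ∧
      (∀ j, r₄ + 1 ≤ j → j ≤ m → ω j 0 = ω r₄ 0 + ((j - (r₄ + 1) : ℕ) : ℤ) ∧ ω j 1 = 0) ∧
      ω m 0 + r₄ + 1 = ω r₄ 0 + m ∧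
      ω p₂ 0 % 2 = 0 ∧ ω r₁ 0 % 2 = 0 ∧ ω r₂ 0 % 2 = 1 ∧ ω p₃ 0 % 2 = 1 ∧ ω r₃ 0 % 2 = 1 ∧ ω p₄ 0 % 2 = 1 ∧
      ω r₄ 0 % 2 = 1 ∧ 0 < ω p₂ 0 ∧ 0 < ω r₁ 0 ∧ 0 < ω r₂ 0 ∧ 0 < ω p₃ 0 ∧ 0 < ω r₃ 0 ∧ 0 < ω p₄ 0 ∧ r₄ < m := by
  classical
  obtain ⟨hpw, hn1, hirr⟩ := mem_ipwb.1 hω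
  obtain ⟨hw, hb⟩ := mem_pwb.1 hpw
  obtain ⟨ha, -⟩ := mem_wbr.1 hw
  obtain ⟨hh, -, -⟩ := mem_archs.1 ha
  obtain ⟨hs, hhp⟩ := mem_hpw.1 hh
  obtain ⟨h0, -, hbw, hinj⟩ := mem_saws_iff.1 hs
  have hX0 : ω 0 0 = 0 := by rw [h0]; rfl
  have hb' : ∀ i, 1 ≤ i → i ≤ m → 0 < ω i 0 ∧ ω i 0 ≤ ω m 0 := fun i h1 h2 => by
    have := hb i h1 h2; rwa [hX0] at this
  have hmem : ∀ i, i ≤ m → i ∈ {i | i ≤ m} := fun i hi => hi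
  have hmD : ∀ i, i ∈ stepsD m ω ↔ i = p₁ ∨ i = p₂ ∨ i = p₃ ∨ i = p₄ := fun i => by
    rw [hD]; simp only [Finset.mem_insert, Finset.mem_singleton]
  have hmU : ∀ i, i ∈ stepsU m ω ↔ i = r₁ ∨ i = r₂ ∨ i = r₃ ∨ i = r₄ := fun i => by
    rw [hU]; simp only [Finset.mem_insert, Finset.mem_singleton]
  obtain ⟨-, -, -, hpar_p₁⟩ := of_mem_stepsD_coord hbw (i := p₁) ((hmD _).2 (by simp))
  have hx_p₁ : ω (p₁ + 1) 0 = ω p₁ 0 := by rw [hP1x, (hR0 p₁ le_rfl).1]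
  have hy_p₁ : ω p₁ 1 = 0 := (hR0 p₁ le_rfl).2
  obtain ⟨hn_p₂, hx_p₂, hys_p₂, hpar_p₂⟩ := of_mem_stepsD_coord hbw (i := p₂) ((hmD _).2 (by simp))
  obtain ⟨hn_r₁, hx_r₁, hys_r₁, hpar_r₁⟩ := of_mem_stepsU_coord hbw (i := r₁) ((hmU _).2 (by simp))
  obtain ⟨hn_r₂, hx_r₂, hys_r₂, hpar_r₂⟩ := of_mem_stepsU_coord hbw (i := r₂) ((hmU _).2 (by simp))
  obtain ⟨hn_p₃, hx_p₃, hys_p₃, hpar_p₃⟩ := of_mem_stepsD_coord hbw (i := p₃) ((hmD _).2 (by simp))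
  obtain ⟨hn_r₃, hx_r₃, hys_r₃, hpar_r₃⟩ := of_mem_stepsU_coord hbw (i := r₃) ((hmU _).2 (by simp))
  obtain ⟨hn_p₄, hx_p₄, hys_p₄, hpar_p₄⟩ := of_mem_stepsD_coord hbw (i := p₄) ((hmD _).2 (by simp))
  obtain ⟨hn_r₄, hx_r₄, hys_r₄, hpar_r₄⟩ := of_mem_stepsU_coord hbw (i := r₄) ((hmU _).2 (by simp))
  have hhor' : ∀ i, i < m → i ≠ p₁ → i ≠ p₂ → i ≠ p₃ → i ≠ p₄ → i ≠ r₁ → i ≠ r₂ → i ≠ r₃ → i ≠ r₄ →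
      ω (i + 1) 1 = ω i 1 ∧ (ω (i + 1) 0 = ω i 0 + 1 ∨ ω (i + 1) 0 = ω i 0 - 1) :=
    fun i hi n1 n2 n3 n4 n5 n6 n7 n8 => hhor i hi (by rw [hmD]; omega) (by rw [hmU]; omega)
  -- run 1 on row `−1`
  obtain ⟨e1, he1, hrun1⟩ := run_const_velocity hinj (a := p₁ + 1) (b := p₂) (by omega) (by omega)
    (fun i hi1 hi2 => hhor' i (by omega) (by omega) (by omega) (by omega) (by omega) (by omega) (by omega) (by omega) (by omega))
  have hy_p₂ : ω p₂ 1 = -1 := by rw [(hrun1 p₂ (by omega) le_rfl).2, hP1y]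
  have hy1_p₂ : ω (p₂ + 1) 1 = -2 := by rw [hys_p₂, hy_p₂]; rfl
  have hparc_p₂ : ω p₂ 0 % 2 = 0 := by rw [hx_p₂, hy1_p₂] at hpar_p₂; omega
  have hpos_p₂ := (hb' p₂ (by omega) (by omega)).1
  -- run 2 on row `−2`
  obtain ⟨e2, he2, hrun2⟩ := run_const_velocity hinj (a := p₂ + 1) (b := r₁) (by omega) (by omega)
    (fun i hi1 hi2 => hhor' i (by omega) (by omega) (by omega) (by omega) (by omega) (by omega) (by omega) (by omega) (by omega))
  have hy_r₁ : ω r₁ 1 = -2 := by rw [(hrun2 r₁ (by omega) le_rfl).2, hy1_p₂]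
  have hy1_r₁ : ω (r₁ + 1) 1 = -1 := by rw [hys_r₁, hy_r₁]; rfl
  have hparc_r₁ : ω r₁ 0 % 2 = 0 := by rw [hy_r₁] at hpar_r₁; omega
  have hpos_r₁ := (hb' r₁ (by omega) (by omega)).1
  -- run 3 on row `−1`
  obtain ⟨e3, he3, hrun3⟩ := run_const_velocity hinj (a := r₁ + 1) (b := r₂) (by omega) (by omega)
    (fun i hi1 hi2 => hhor' i (by omega) (by omega) (by omega) (by omega) (by omega) (by omega) (by omega) (by omega) (by omega))
  have hy_r₂ : ω r₂ 1 = -1 := by rw [(hrun3 r₂ (by omega) le_rfl).2, hy1_r₁]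
  have hy1_r₂ : ω (r₂ + 1) 1 = 0 := by rw [hys_r₂, hy_r₂]; rfl
  have hparc_r₂ : ω r₂ 0 % 2 = 1 := by rw [hy_r₂] at hpar_r₂; omega
  have hpos_r₂ := (hb' r₂ (by omega) (by omega)).1
  -- run 4 on row `0`
  obtain ⟨e4, he4, hrun4⟩ := run_const_velocity hinj (a := r₂ + 1) (b := p₃) (by omega) (by omega)
    (fun i hi1 hi2 => hhor' i (by omega) (by omega) (by omega) (by omega) (by omega) (by omega) (by omega) (by omega) (by omega))
  have hy_p₃ : ω p₃ 1 = 0 := by rw [(hrun4 p₃ (by omega) le_rfl).2, hy1_r₂]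
  have hy1_p₃ : ω (p₃ + 1) 1 = -1 := by rw [hys_p₃, hy_p₃]; rfl
  have hparc_p₃ : ω p₃ 0 % 2 = 1 := by rw [hx_p₃, hy1_p₃] at hpar_p₃; omega
  have hpos_p₃ := (hb' p₃ (by omega) (by omega)).1
  -- run 5 on row `−1`
  obtain ⟨e5, he5, hrun5⟩ := run_const_velocity hinj (a := p₃ + 1) (b := r₃) (by omega) (by omega)
    (fun i hi1 hi2 => hhor' i (by omega) (by omega) (by omega) (by omega) (by omega) (by omega) (by omega) (by omega) (by omega))
  have hy_r₃ : ω r₃ 1 = -1 := by rw [(hrun5 r₃ (by omega) le_rfl).2, hy1_p₃]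
  have hy1_r₃ : ω (r₃ + 1) 1 = 0 := by rw [hys_r₃, hy_r₃]; rfl
  have hparc_r₃ : ω r₃ 0 % 2 = 1 := by rw [hy_r₃] at hpar_r₃; omega
  have hpos_r₃ := (hb' r₃ (by omega) (by omega)).1
  -- run 6 on row `0`
  obtain ⟨e6, he6, hrun6⟩ := run_const_velocity hinj (a := r₃ + 1) (b := p₄) (by omega) (by omega)
    (fun i hi1 hi2 => hhor' i (by omega) (by omega) (by omega) (by omega) (by omega) (by omega) (by omega) (by omega) (by omega))
  have hy_p₄ : ω p₄ 1 = 0 := by rw [(hrun6 p₄ (by omega) le_rfl).2, hy1_r₃]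
  have hy1_p₄ : ω (p₄ + 1) 1 = -1 := by rw [hys_p₄, hy_p₄]; rfl
  have hparc_p₄ : ω p₄ 0 % 2 = 1 := by rw [hx_p₄, hy1_p₄] at hpar_p₄; omega
  have hpos_p₄ := (hb' p₄ (by omega) (by omega)).1
  -- run 7 on row `−1`
  obtain ⟨e7, he7, hrun7⟩ := run_const_velocity hinj (a := p₄ + 1) (b := r₄) (by omega) (by omega)
    (fun i hi1 hi2 => hhor' i (by omega) (by omega) (by omega) (by omega) (by omega) (by omega) (by omega) (by omega) (by omega))
  have hy_r₄ : ω r₄ 1 = -1 := by rw [(hrun7 r₄ (by omega) le_rfl).2, hy1_p₄]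
  have hy1_r₄ : ω (r₄ + 1) 1 = 0 := by rw [hys_r₄, hy_r₄]; rfl
  have hparc_r₄ : ω r₄ 0 % 2 = 1 := by rw [hy_r₄] at hpar_r₄; omega
  have htev_r₂ : r₂ % 2 = 0 := by
    have := parity_apply hs (show r₂ ≤ m by omega); rw [hy_r₂] at this; omega
  have htodd_p₃ : p₃ % 2 = 1 := by
    have := parity_apply hs (show p₃ ≤ m by omega); rw [hy_p₃] at this; omega
  have htev_r₃ : r₃ % 2 = 0 := by
    have := parity_apply hs (show r₃ ≤ m by omega); rw [hy_r₃] at this; omega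
  have htodd_p₄ : p₄ % 2 = 1 := by
    have := parity_apply hs (show p₄ ≤ m by omega); rw [hy_p₄] at this; omega
  have hsev : r₄ % 2 = 0 := by have := parity_apply hs (show r₄ ≤ m by omega); rw [hy_r₄] at this; omega
  -- the final run on the wall goes right
  obtain ⟨e8, he8, hrun8⟩ := run_const_velocity hinj (a := r₄ + 1) (b := m) (by omega) le_rfl
    (fun i hi1 hi2 => hhor' i (by omega) (by omega) (by omega) (by omega) (by omega) (by omega) (by omega) (by omega)
      (by omega))
  obtain rfl : e8 = 1 := by
    rcases he8 with h | rfl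
    · exact h
    exfalso
    have hN := (hrun8 m (by omega) le_rfl).1
    have hbn := (hb' (r₄ + 1) (by omega) (by omega)).2
    rw [hx_r₄] at hN hbn
    omega
  have hR8 : ∀ j, r₄ + 1 ≤ j → j ≤ m → ω j 0 = ω r₄ 0 + ((j - (r₄ + 1) : ℕ) : ℤ) ∧ ω j 1 = 0 := fun j hj1 hj2 => by
    obtain ⟨hx, hy⟩ := hrun8 j hj1 hj2
    rw [hx_r₄] at hx; rw [hy1_r₄] at hy
    exact ⟨by rw [hx]; ring, hy⟩
  have hN' : ω m 0 + r₄ + 1 = ω r₄ 0 + m := by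
    rw [(hR8 m (by omega) le_rfl).1]; omega
  refine ⟨e1, e2, e3, e4, e5, e6, e7, he1, he2, he3, he4, he5, he6, he7,
    fun i hi1 hi2 => ⟨by rw [(hrun1 i hi1 hi2).1, hP1x], by rw [(hrun1 i hi1 hi2).2, hP1y]⟩,
    fun i hi1 hi2 => ⟨by rw [(hrun2 i hi1 hi2).1, hx_p₂], by rw [(hrun2 i hi1 hi2).2, hy1_p₂]⟩,
    fun i hi1 hi2 => ⟨by rw [(hrun3 i hi1 hi2).1, hx_r₁], by rw [(hrun3 i hi1 hi2).2, hy1_r₁]⟩,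
    fun i hi1 hi2 => ⟨by rw [(hrun4 i hi1 hi2).1, hx_r₂], by rw [(hrun4 i hi1 hi2).2, hy1_r₂]⟩,
    fun i hi1 hi2 => ⟨by rw [(hrun5 i hi1 hi2).1, hx_p₃], by rw [(hrun5 i hi1 hi2).2, hy1_p₃]⟩,
    fun i hi1 hi2 => ⟨by rw [(hrun6 i hi1 hi2).1, hx_r₃], by rw [(hrun6 i hi1 hi2).2, hy1_r₃]⟩,
    fun i hi1 hi2 => ⟨by rw [(hrun7 i hi1 hi2).1, hx_p₄], by rw [(hrun7 i hi1 hi2).2, hy1_p₄]⟩,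
    hR8, hN', hparc_p₂, hparc_r₁, hparc_r₂, hparc_p₃, hparc_r₃, hparc_p₄, hparc_r₄, hpos_p₂, hpos_r₁, hpos_r₂, hpos_p₃,
    hpos_r₃, hpos_p₄, hn_r₄⟩


/-- The visit count of the order `D D U U D U D U`: `p₁ + p₃ + p₄ + m = r₂ + r₃ + r₄ + 2k + 3` (wall visits on the initial
run, on the two wall runs and on the final run; `visits_add` / `visits_add_eq_left`).  Split off `dduududu4_runs` to keep
both under the half heartbeat budget.  OURS (routine).
[cite: MadrasSlade1993, §4.2, Definition 4.2.1 (p. 90), (4.2.2); EntingJensen2009, §7.4.2, Fig. 7.10] -/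
theorem dduududu4_visits {k m : ℕ} (hm : m = 6 * k + 4) (hω : ω ∈ ipwb m) (hv : visits m ω = k)
    {p₁ p₂ p₃ p₄ r₁ r₂ r₃ r₄ : ℕ} (hD : stepsD m ω = {p₁, p₂, p₃, p₄}) (hU : stepsU m ω = {r₁, r₂, r₃, r₄}) (h12 : p₁ < p₂)
    (h23 : p₂ < p₃) (h34 : p₃ < p₄) (hr12 : r₁ < r₂) (hr23 : r₂ < r₃) (hr34 : r₃ < r₄) (ht2 : p₂ < r₁) (ht4 : r₂ < p₃)
    (ht5 : p₃ < r₃) (ht6 : r₃ < p₄) (ht7 : p₄ < r₄) (hp1 : 1 ≤ p₁) (hR0 : ∀ i, i ≤ p₁ → ω i 0 = i ∧ ω i 1 = 0)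
    (hP1x : ω (p₁ + 1) 0 = p₁) (hP1y : ω (p₁ + 1) 1 = -1)
    (hhor : ∀ i, i < m → i ∉ stepsD m ω → i ∉ stepsU m ω →
      ω (i + 1) 1 = ω i 1 ∧ (ω (i + 1) 0 = ω i 0 + 1 ∨ ω (i + 1) 0 = ω i 0 - 1)) :
    p₁ + (p₃ + p₄) + m = (r₂ + r₃) + r₄ + 2 * k + 3 := by
  classical
  obtain ⟨hpw, hn1, hirr⟩ := mem_ipwb.1 hω
  obtain ⟨hw, hb⟩ := mem_pwb.1 hpw
  obtain ⟨ha, -⟩ := mem_wbr.1 hw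
  obtain ⟨hh, -, -⟩ := mem_archs.1 ha
  obtain ⟨hs, hhp⟩ := mem_hpw.1 hh
  obtain ⟨h0, -, hbw, hinj⟩ := mem_saws_iff.1 hs
  have hX0 : ω 0 0 = 0 := by rw [h0]; rfl
  have hb' : ∀ i, 1 ≤ i → i ≤ m → 0 < ω i 0 ∧ ω i 0 ≤ ω m 0 := fun i h1 h2 => by
    have := hb i h1 h2; rwa [hX0] at this
  have hmem : ∀ i, i ≤ m → i ∈ {i | i ≤ m} := fun i hi => hi
  obtain ⟨e₁, e₂, e₃, e₄, e₅, e₆, e₇, -, -, -, he4, he5, he6, he7, hrun1, hrun2, hrun3, hrun4, hrun5, hrun6, hrun7, hR8, hN',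
    -, -, hparc_r₂, hparc_p₃, hparc_r₃, hparc_p₄, hparc_r₄, -, -, hpos_r₂, hpos_p₃, hpos_r₃, hpos_p₄, hn_r₄⟩ :=
    dduududu4_runs hm hω hv hD hU h12 h23 h34 hr12 hr23 hr34 ht2 ht4 ht5 ht6 ht7 hp1 hR0 hP1x hP1y hhor
  have hy_p₃ := (hrun4 p₃ (by omega) le_rfl).2
  have hy_r₂ := (hrun3 r₂ (by omega) le_rfl).2
  have hy_r₃ := (hrun5 r₃ (by omega) le_rfl).2
  have hy_p₄ := (hrun6 p₄ (by omega) le_rfl).2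
  have hy_r₄ := (hrun7 r₄ (by omega) le_rfl).2
  have hR4' := hR8 (r₄ + 1) le_rfl (by omega)
  have hW7 := hrun6 (r₃ + 1) le_rfl (by omega)
  have hB2 := hrun5 (p₃ + 1) le_rfl (by omega)
  have hW5 := hrun4 (r₂ + 1) le_rfl (by omega)
  simp only [Nat.sub_self, Nat.cast_zero, mul_zero, add_zero] at hR4' hW7 hB2 hW5
  have htev_r₂ : r₂ % 2 = 0 := by
    have := parity_apply hs (show r₂ ≤ m by omega); rw [hy_r₂] at this; omega
  have htodd_p₃ : p₃ % 2 = 1 := by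
    have := parity_apply hs (show p₃ ≤ m by omega); rw [hy_p₃] at this; omega
  have htev_r₃ : r₃ % 2 = 0 := by
    have := parity_apply hs (show r₃ ≤ m by omega); rw [hy_r₃] at this; omega
  have htodd_p₄ : p₄ % 2 = 1 := by
    have := parity_apply hs (show p₄ ≤ m by omega); rw [hy_p₄] at this; omega
  have hsev : r₄ % 2 = 0 := by
    have := parity_apply hs (show r₄ ≤ m by omega); rw [hy_r₄] at this; omega
  have hpodd : p₁ % 2 = 1 := by
    obtain ⟨-, -, -, hpar⟩ := of_mem_stepsD_coord hbw (i := p₁) (by rw [hD]; simp)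
    rw [hP1x, hP1y] at hpar; omega
  have hvf : visits m ω = p₁ / 2 + (p₃ - r₂) / 2 + (p₄ - r₃) / 2 + (m - r₄) / 2 := by
    have hv1 : visits p₁ ω = p₁ / 2 := visits_eq_div_two_of_wall (fun i _ hi2 => (hR0 i hi2).2)
    have hvA1 : visits r₂ ω = visits p₁ ω := by
      have := visits_add_eq_left (k := p₁) (b := r₂ - p₁) (ζ := ω) (fun j hj1 hj2 => ?_)
      · rwa [show p₁ + (r₂ - p₁) = r₂ by omega] at this
      rintro ⟨-, hy⟩
      rcases Nat.lt_or_ge (p₁ + j) (p₂ + 1) with hj1' | hj1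
      · have := (hrun1 (p₁ + j) (by omega) (by omega)).2; omega
      rcases Nat.lt_or_ge (p₁ + j) (r₁ + 1) with hj2' | hj2
      · have := (hrun2 (p₁ + j) hj1 (by omega)).2; omega
      · have := (hrun3 (p₁ + j) hj2 (by omega)).2; omega
    have hvB1 : visits p₃ ω = visits r₂ ω + visits (p₃ - r₂) (fun _ => (0 : Site 2)) := by
      have := visits_add (a := r₂) (b := p₃ - r₂) (ζ := ω) (ξ := fun _ => (0 : Site 2)) htev_r₂ (fun j hj1 hj2 => ?_)
      · rwa [show r₂ + (p₃ - r₂) = p₃ by omega] at this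
      rw [(hrun4 (r₂ + j) (by omega) (by omega)).2]; rfl
    have hvC1 : visits (p₃ - r₂) (fun _ => (0 : Site 2)) = (p₃ - r₂) / 2 :=
      visits_eq_div_two_of_wall (fun i _ _ => rfl)
    have hvA2 : visits r₃ ω = visits p₃ ω := by
      have := visits_add_eq_left (k := p₃) (b := r₃ - p₃) (ζ := ω) (fun j hj1 hj2 => ?_)
      · rwa [show p₃ + (r₃ - p₃) = r₃ by omega] at this
      rintro ⟨-, hy⟩
      · have := (hrun5 (p₃ + j) (by omega) (by omega)).2; omega
    have hvB2 : visits p₄ ω = visits r₃ ω + visits (p₄ - r₃) (fun _ => (0 : Site 2)) := by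
      have := visits_add (a := r₃) (b := p₄ - r₃) (ζ := ω) (ξ := fun _ => (0 : Site 2)) htev_r₃ (fun j hj1 hj2 => ?_)
      · rwa [show r₃ + (p₄ - r₃) = p₄ by omega] at this
      rw [(hrun6 (r₃ + j) (by omega) (by omega)).2]; rfl
    have hvC2 : visits (p₄ - r₃) (fun _ => (0 : Site 2)) = (p₄ - r₃) / 2 :=
      visits_eq_div_two_of_wall (fun i _ _ => rfl)
    have hvA3 : visits r₄ ω = visits p₄ ω := by
      have := visits_add_eq_left (k := p₄) (b := r₄ - p₄) (ζ := ω) (fun j hj1 hj2 => ?_)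
      · rwa [show p₄ + (r₄ - p₄) = r₄ by omega] at this
      rintro ⟨-, hy⟩
      · have := (hrun7 (p₄ + j) (by omega) (by omega)).2; omega
    have hv3 : visits m ω = visits r₄ ω + visits (m - r₄) (fun _ => (0 : Site 2)) := by
      have := visits_add (a := r₄) (b := m - r₄) (ζ := ω) (ξ := fun _ => (0 : Site 2)) hsev (fun j hj1 hj2 => ?_)
      · rwa [show r₄ + (m - r₄) = m by omega] at this
      rw [(hR8 (r₄ + j) (by omega) (by omega)).2]; rfl
    have hv4 : visits (m - r₄) (fun _ => (0 : Site 2)) = (m - r₄) / 2 := visits_eq_div_two_of_wall (fun i _ _ => rfl)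
    rw [hv3, hvA3, hvB2, hvA2, hvB1, hvA1, hv1, hvC1, hvC2, hv4]
  rw [hvf] at hv
  exact visits_count_tb_w2 hm hv hpodd htodd_p₃ htev_r₂ (show r₂ < p₃ by omega) htodd_p₄ htev_r₃ (show r₃ < p₄ by omega) hsev hn_r₄

/-- Step 1 for `dduududu_slack_four_false`: the LAST bump plateau goes right (a left plateau would be crossed by the final
wall run at its dive column).  OURS (routine).
[cite: MadrasSlade1993, §4.2, Definition 4.2.1 (p. 90), remark before (4.2.21) (p. 94); EntingJensen2009, §7.4.2, Fig. 7.10] -/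
theorem dduududu_plateau₂ {k m : ℕ} (hm : m = 6 * k + 4) (hω : ω ∈ ipwb m) (hv : visits m ω = k)
    {p₁ p₂ p₃ p₄ r₁ r₂ r₃ r₄ : ℕ} (hD : stepsD m ω = {p₁, p₂, p₃, p₄}) (hU : stepsU m ω = {r₁, r₂, r₃, r₄}) (h12 : p₁ < p₂)
    (h23 : p₂ < p₃) (h34 : p₃ < p₄) (hr12 : r₁ < r₂) (hr23 : r₂ < r₃) (hr34 : r₃ < r₄) (ht2 : p₂ < r₁) (ht4 : r₂ < p₃)
    (ht5 : p₃ < r₃) (ht6 : r₃ < p₄) (ht7 : p₄ < r₄) (hp1 : 1 ≤ p₁) (hR0 : ∀ i, i ≤ p₁ → ω i 0 = i ∧ ω i 1 = 0)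
    (hP1x : ω (p₁ + 1) 0 = p₁) (hP1y : ω (p₁ + 1) 1 = -1)
    (hhor : ∀ i, i < m → i ∉ stepsD m ω → i ∉ stepsU m ω →
      ω (i + 1) 1 = ω i 1 ∧ (ω (i + 1) 0 = ω i 0 + 1 ∨ ω (i + 1) 0 = ω i 0 - 1)) :
    ∀ i, p₄ + 1 ≤ i → i ≤ r₄ → ω i 0 = ω p₄ 0 + ((i - (p₄ + 1) : ℕ) : ℤ) ∧ ω i 1 = -1 := by
  classical
  obtain ⟨hpw, hn1, hirr⟩ := mem_ipwb.1 hω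
  obtain ⟨hw, hb⟩ := mem_pwb.1 hpw
  obtain ⟨ha, -⟩ := mem_wbr.1 hw
  obtain ⟨hh, -, -⟩ := mem_archs.1 ha
  obtain ⟨hs, hhp⟩ := mem_hpw.1 hh
  obtain ⟨h0, -, hbw, hinj⟩ := mem_saws_iff.1 hs
  have hX0 : ω 0 0 = 0 := by rw [h0]; rfl
  have hb' : ∀ i, 1 ≤ i → i ≤ m → 0 < ω i 0 ∧ ω i 0 ≤ ω m 0 := fun i h1 h2 => by
    have := hb i h1 h2; rwa [hX0] at this
  have hmem : ∀ i, i ≤ m → i ∈ {i | i ≤ m} := fun i hi => hi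
  obtain ⟨e₁, e₂, e₃, e₄, e₅, e₆, e₇, -, -, -, he4, he5, he6, he7, hrun1, hrun2, hrun3, hrun4, hrun5, hrun6, hrun7, hR8, hN',
    -, -, hparc_r₂, hparc_p₃, hparc_r₃, hparc_p₄, hparc_r₄, -, -, hpos_r₂, hpos_p₃, hpos_r₃, hpos_p₄, hn_r₄⟩ :=
    dduududu4_runs hm hω hv hD hU h12 h23 h34 hr12 hr23 hr34 ht2 ht4 ht5 ht6 ht7 hp1 hR0 hP1x hP1y hhor
  have hy_p₃ := (hrun4 p₃ (by omega) le_rfl).2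
  have hy_r₂ := (hrun3 r₂ (by omega) le_rfl).2
  have hy_r₃ := (hrun5 r₃ (by omega) le_rfl).2
  have hy_p₄ := (hrun6 p₄ (by omega) le_rfl).2
  have hy_r₄ := (hrun7 r₄ (by omega) le_rfl).2
  have hR4' := hR8 (r₄ + 1) le_rfl (by omega)
  have hW7 := hrun6 (r₃ + 1) le_rfl (by omega)
  have hB2 := hrun5 (p₃ + 1) le_rfl (by omega)
  have hW5 := hrun4 (r₂ + 1) le_rfl (by omega)
  simp only [Nat.sub_self, Nat.cast_zero, mul_zero, add_zero] at hR4' hW7 hB2 hW5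
  have hR7 := (hrun7 r₄ (by omega) le_rfl).1
  obtain rfl : e₇ = 1 := by
    rcases he7 with h | rfl
    · exact h
    exfalso
    have hle := (hb' p₄ (by omega) (by omega)).2
    obtain ⟨hjx, hjy⟩ := hR8 (2 * r₄ - p₄) (by omega) (by omega)
    have hc := hinj (hmem (2 * r₄ - p₄) (by omega)) (hmem p₄ (by omega)) (site_ext_tb (by omega) (by rw [hjy, hy_p₄]))
    omega
  simpa only [one_mul] using hrun7

/-- Step 2 for `dduududu_slack_four_false`: the SECOND wall run goes right (else the walk is back on the wall at a site of
that run, or the last plateau passes under the end of the first bump).  OURS (routine).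
[cite: MadrasSlade1993, §4.2, Definition 4.2.1 (p. 90), remark before (4.2.21) (p. 94); EntingJensen2009, §7.4.2, Fig. 7.10] -/
theorem dduududu_wallRun₂ {k m : ℕ} (hm : m = 6 * k + 4) (hω : ω ∈ ipwb m) (hv : visits m ω = k)
    {p₁ p₂ p₃ p₄ r₁ r₂ r₃ r₄ : ℕ} (hD : stepsD m ω = {p₁, p₂, p₃, p₄}) (hU : stepsU m ω = {r₁, r₂, r₃, r₄}) (h12 : p₁ < p₂)
    (h23 : p₂ < p₃) (h34 : p₃ < p₄) (hr12 : r₁ < r₂) (hr23 : r₂ < r₃) (hr34 : r₃ < r₄) (ht2 : p₂ < r₁) (ht4 : r₂ < p₃)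
    (ht5 : p₃ < r₃) (ht6 : r₃ < p₄) (ht7 : p₄ < r₄) (hp1 : 1 ≤ p₁) (hR0 : ∀ i, i ≤ p₁ → ω i 0 = i ∧ ω i 1 = 0)
    (hP1x : ω (p₁ + 1) 0 = p₁) (hP1y : ω (p₁ + 1) 1 = -1)
    (hhor : ∀ i, i < m → i ∉ stepsD m ω → i ∉ stepsU m ω →
      ω (i + 1) 1 = ω i 1 ∧ (ω (i + 1) 0 = ω i 0 + 1 ∨ ω (i + 1) 0 = ω i 0 - 1)) :
    ∀ i, r₃ + 1 ≤ i → i ≤ p₄ → ω i 0 = ω r₃ 0 + ((i - (r₃ + 1) : ℕ) : ℤ) ∧ ω i 1 = 0 := by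
  classical
  obtain ⟨hpw, hn1, hirr⟩ := mem_ipwb.1 hω
  obtain ⟨hw, hb⟩ := mem_pwb.1 hpw
  obtain ⟨ha, -⟩ := mem_wbr.1 hw
  obtain ⟨hh, -, -⟩ := mem_archs.1 ha
  obtain ⟨hs, hhp⟩ := mem_hpw.1 hh
  obtain ⟨h0, -, hbw, hinj⟩ := mem_saws_iff.1 hs
  have hX0 : ω 0 0 = 0 := by rw [h0]; rfl
  have hb' : ∀ i, 1 ≤ i → i ≤ m → 0 < ω i 0 ∧ ω i 0 ≤ ω m 0 := fun i h1 h2 => by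
    have := hb i h1 h2; rwa [hX0] at this
  have hmem : ∀ i, i ≤ m → i ∈ {i | i ≤ m} := fun i hi => hi
  obtain ⟨e₁, e₂, e₃, e₄, e₅, e₆, e₇, -, -, -, he4, he5, he6, he7, hrun1, hrun2, hrun3, hrun4, hrun5, hrun6, hrun7, hR8, hN',
    -, -, hparc_r₂, hparc_p₃, hparc_r₃, hparc_p₄, hparc_r₄, -, -, hpos_r₂, hpos_p₃, hpos_r₃, hpos_p₄, hn_r₄⟩ :=
    dduududu4_runs hm hω hv hD hU h12 h23 h34 hr12 hr23 hr34 ht2 ht4 ht5 ht6 ht7 hp1 hR0 hP1x hP1y hhor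
  have hy_p₃ := (hrun4 p₃ (by omega) le_rfl).2
  have hy_r₂ := (hrun3 r₂ (by omega) le_rfl).2
  have hy_r₃ := (hrun5 r₃ (by omega) le_rfl).2
  have hy_p₄ := (hrun6 p₄ (by omega) le_rfl).2
  have hy_r₄ := (hrun7 r₄ (by omega) le_rfl).2
  have hR4' := hR8 (r₄ + 1) le_rfl (by omega)
  have hW7 := hrun6 (r₃ + 1) le_rfl (by omega)
  have hB2 := hrun5 (p₃ + 1) le_rfl (by omega)
  have hW5 := hrun4 (r₂ + 1) le_rfl (by omega)
  simp only [Nat.sub_self, Nat.cast_zero, mul_zero, add_zero] at hR4' hW7 hB2 hW5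
  have hrun7' := dduududu_plateau₂ hm hω hv hD hU h12 h23 h34 hr12 hr23 hr34 ht2 ht4 ht5 ht6 ht7 hp1 hR0 hP1x hP1y hhor
  have hR7 := (hrun7' r₄ (by omega) le_rfl).1
  have hP4 := (hrun6 p₄ (by omega) le_rfl).1
  obtain rfl : e₆ = 1 := by
    rcases he6 with h | rfl
    · exact h
    exfalso
    rcases Nat.lt_or_ge (r₃ + r₄) (2 * p₄) with hlt | hge
    · obtain ⟨hjx, hjy⟩ := hrun6 (2 * p₄ - r₄ + 1) (by omega) (by omega)
      have hc := hinj (hmem (2 * p₄ - r₄ + 1) (by omega)) (hmem (r₄ + 1) (by omega))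
        (site_ext_tb (by rw [hR4'.1]; omega) (by rw [hjy, hR4'.2]))
      omega
    · obtain ⟨hjx, hjy⟩ := hrun7' (2 * p₄ - r₃) (by omega) (by omega)
      have hc := hinj (hmem (2 * p₄ - r₃) (by omega)) (hmem r₃ (by omega)) (site_ext_tb (by omega) (by rw [hjy, hy_r₃]))
      omega
  simpa only [one_mul] using hrun6

/-- Step 3 for `dduududu_slack_four_false`: the FIRST bump plateau goes right.  A left plateau starts under the wall site
`ω p₃` and ends under a wall column which the rest of the walk (second wall run, second bump, final run, all sweeping to
the right) must pass: the second wall run would cross `ω p₃`, the second bump would cross the plateau's first site, or the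
final run would cross `ω p₃`.  OURS (routine).
[cite: MadrasSlade1993, §4.2, Definition 4.2.1 (p. 90), remark before (4.2.21) (p. 94); EntingJensen2009, §7.4.2, Fig. 7.10] -/
theorem dduududu_plateau₁ {k m : ℕ} (hm : m = 6 * k + 4) (hω : ω ∈ ipwb m) (hv : visits m ω = k)
    {p₁ p₂ p₃ p₄ r₁ r₂ r₃ r₄ : ℕ} (hD : stepsD m ω = {p₁, p₂, p₃, p₄}) (hU : stepsU m ω = {r₁, r₂, r₃, r₄}) (h12 : p₁ < p₂)
    (h23 : p₂ < p₃) (h34 : p₃ < p₄) (hr12 : r₁ < r₂) (hr23 : r₂ < r₃) (hr34 : r₃ < r₄) (ht2 : p₂ < r₁) (ht4 : r₂ < p₃)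
    (ht5 : p₃ < r₃) (ht6 : r₃ < p₄) (ht7 : p₄ < r₄) (hp1 : 1 ≤ p₁) (hR0 : ∀ i, i ≤ p₁ → ω i 0 = i ∧ ω i 1 = 0)
    (hP1x : ω (p₁ + 1) 0 = p₁) (hP1y : ω (p₁ + 1) 1 = -1)
    (hhor : ∀ i, i < m → i ∉ stepsD m ω → i ∉ stepsU m ω →
      ω (i + 1) 1 = ω i 1 ∧ (ω (i + 1) 0 = ω i 0 + 1 ∨ ω (i + 1) 0 = ω i 0 - 1)) :
    ∀ i, p₃ + 1 ≤ i → i ≤ r₃ → ω i 0 = ω p₃ 0 + ((i - (p₃ + 1) : ℕ) : ℤ) ∧ ω i 1 = -1 := by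
  classical
  obtain ⟨hpw, hn1, hirr⟩ := mem_ipwb.1 hω
  obtain ⟨hw, hb⟩ := mem_pwb.1 hpw
  obtain ⟨ha, -⟩ := mem_wbr.1 hw
  obtain ⟨hh, -, -⟩ := mem_archs.1 ha
  obtain ⟨hs, hhp⟩ := mem_hpw.1 hh
  obtain ⟨h0, -, hbw, hinj⟩ := mem_saws_iff.1 hs
  have hX0 : ω 0 0 = 0 := by rw [h0]; rfl
  have hb' : ∀ i, 1 ≤ i → i ≤ m → 0 < ω i 0 ∧ ω i 0 ≤ ω m 0 := fun i h1 h2 => by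
    have := hb i h1 h2; rwa [hX0] at this
  have hmem : ∀ i, i ≤ m → i ∈ {i | i ≤ m} := fun i hi => hi
  obtain ⟨e₁, e₂, e₃, e₄, e₅, e₆, e₇, -, -, -, he4, he5, he6, he7, hrun1, hrun2, hrun3, hrun4, hrun5, hrun6, hrun7, hR8, hN',
    -, -, hparc_r₂, hparc_p₃, hparc_r₃, hparc_p₄, hparc_r₄, -, -, hpos_r₂, hpos_p₃, hpos_r₃, hpos_p₄, hn_r₄⟩ :=
    dduududu4_runs hm hω hv hD hU h12 h23 h34 hr12 hr23 hr34 ht2 ht4 ht5 ht6 ht7 hp1 hR0 hP1x hP1y hhor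
  have hy_p₃ := (hrun4 p₃ (by omega) le_rfl).2
  have hy_r₂ := (hrun3 r₂ (by omega) le_rfl).2
  have hy_r₃ := (hrun5 r₃ (by omega) le_rfl).2
  have hy_p₄ := (hrun6 p₄ (by omega) le_rfl).2
  have hy_r₄ := (hrun7 r₄ (by omega) le_rfl).2
  have hR4' := hR8 (r₄ + 1) le_rfl (by omega)
  have hW7 := hrun6 (r₃ + 1) le_rfl (by omega)
  have hB2 := hrun5 (p₃ + 1) le_rfl (by omega)
  have hW5 := hrun4 (r₂ + 1) le_rfl (by omega)
  simp only [Nat.sub_self, Nat.cast_zero, mul_zero, add_zero] at hR4' hW7 hB2 hW5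
  have hrun7' := dduududu_plateau₂ hm hω hv hD hU h12 h23 h34 hr12 hr23 hr34 ht2 ht4 ht5 ht6 ht7 hp1 hR0 hP1x hP1y hhor
  have hrun6' := dduududu_wallRun₂ hm hω hv hD hU h12 h23 h34 hr12 hr23 hr34 ht2 ht4 ht5 ht6 ht7 hp1 hR0 hP1x hP1y hhor
  have hR7 := (hrun7' r₄ (by omega) le_rfl).1
  have hP4 := (hrun6' p₄ (by omega) le_rfl).1
  have hR3 := (hrun5 r₃ (by omega) le_rfl).1
  obtain rfl : e₅ = 1 := by
    rcases he5 with h | rfl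
    · exact h
    exfalso
    rcases Nat.lt_or_ge (p₃ + p₄) (2 * r₃) with hlt | hge
    · rcases Nat.lt_or_ge (2 * r₃ + 1) (p₃ + r₄) with hlt' | hge'
      · -- the second bump passes under the first plateau's start `ω (p₃ + 1)`
        obtain ⟨hjx, hjy⟩ := hrun7' (2 * r₃ - p₃ + 1) (by omega) (by omega)
        have hc := hinj (hmem (2 * r₃ - p₃ + 1) (by omega)) (hmem (p₃ + 1) (by omega))
          (site_ext_tb (by rw [hB2.1]; omega) (by rw [hjy, hB2.2]))
        omega
      · -- the final run crosses the dive site `ω p₃`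
        have hle := (hb' p₃ (by omega) (by omega)).2
        obtain ⟨hjx, hjy⟩ := hR8 (2 * r₃ - p₃ + 2) (by omega) (by omega)
        have hc := hinj (hmem (2 * r₃ - p₃ + 2) (by omega)) (hmem p₃ (by omega))
          (site_ext_tb (by omega) (by rw [hjy, hy_p₃]))
        omega
    · -- the second wall run crosses the dive site `ω p₃`
      obtain ⟨hjx, hjy⟩ := hrun6' (2 * r₃ - p₃) (by omega) (by omega)
      have hc := hinj (hmem (2 * r₃ - p₃) (by omega)) (hmem p₃ (by omega)) (site_ext_tb (by omega) (by rw [hjy, hy_p₃]))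
      omega
  simpa only [one_mul] using hrun5

/-- Step 4 for `dduududu_slack_four_false`: the FIRST wall run goes right (else the first bump passes under the hairpin's
return site `ω r₂`, or the second wall run starts on a site of the first).  OURS (routine).
[cite: MadrasSlade1993, §4.2, Definition 4.2.1 (p. 90), remark before (4.2.21) (p. 94); EntingJensen2009, §7.4.2, Fig. 7.10] -/
theorem dduududu_wallRun₁ {k m : ℕ} (hm : m = 6 * k + 4) (hω : ω ∈ ipwb m) (hv : visits m ω = k)
    {p₁ p₂ p₃ p₄ r₁ r₂ r₃ r₄ : ℕ} (hD : stepsD m ω = {p₁, p₂, p₃, p₄}) (hU : stepsU m ω = {r₁, r₂, r₃, r₄}) (h12 : p₁ < p₂)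
    (h23 : p₂ < p₃) (h34 : p₃ < p₄) (hr12 : r₁ < r₂) (hr23 : r₂ < r₃) (hr34 : r₃ < r₄) (ht2 : p₂ < r₁) (ht4 : r₂ < p₃)
    (ht5 : p₃ < r₃) (ht6 : r₃ < p₄) (ht7 : p₄ < r₄) (hp1 : 1 ≤ p₁) (hR0 : ∀ i, i ≤ p₁ → ω i 0 = i ∧ ω i 1 = 0)
    (hP1x : ω (p₁ + 1) 0 = p₁) (hP1y : ω (p₁ + 1) 1 = -1)
    (hhor : ∀ i, i < m → i ∉ stepsD m ω → i ∉ stepsU m ω →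
      ω (i + 1) 1 = ω i 1 ∧ (ω (i + 1) 0 = ω i 0 + 1 ∨ ω (i + 1) 0 = ω i 0 - 1)) :
    ∀ i, r₂ + 1 ≤ i → i ≤ p₃ → ω i 0 = ω r₂ 0 + ((i - (r₂ + 1) : ℕ) : ℤ) ∧ ω i 1 = 0 := by
  classical
  obtain ⟨hpw, hn1, hirr⟩ := mem_ipwb.1 hω
  obtain ⟨hw, hb⟩ := mem_pwb.1 hpw
  obtain ⟨ha, -⟩ := mem_wbr.1 hw
  obtain ⟨hh, -, -⟩ := mem_archs.1 ha
  obtain ⟨hs, hhp⟩ := mem_hpw.1 hh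
  obtain ⟨h0, -, hbw, hinj⟩ := mem_saws_iff.1 hs
  have hX0 : ω 0 0 = 0 := by rw [h0]; rfl
  have hb' : ∀ i, 1 ≤ i → i ≤ m → 0 < ω i 0 ∧ ω i 0 ≤ ω m 0 := fun i h1 h2 => by
    have := hb i h1 h2; rwa [hX0] at this
  have hmem : ∀ i, i ≤ m → i ∈ {i | i ≤ m} := fun i hi => hi
  obtain ⟨e₁, e₂, e₃, e₄, e₅, e₆, e₇, -, -, -, he4, he5, he6, he7, hrun1, hrun2, hrun3, hrun4, hrun5, hrun6, hrun7, hR8, hN',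
    -, -, hparc_r₂, hparc_p₃, hparc_r₃, hparc_p₄, hparc_r₄, -, -, hpos_r₂, hpos_p₃, hpos_r₃, hpos_p₄, hn_r₄⟩ :=
    dduududu4_runs hm hω hv hD hU h12 h23 h34 hr12 hr23 hr34 ht2 ht4 ht5 ht6 ht7 hp1 hR0 hP1x hP1y hhor
  have hy_p₃ := (hrun4 p₃ (by omega) le_rfl).2
  have hy_r₂ := (hrun3 r₂ (by omega) le_rfl).2
  have hy_r₃ := (hrun5 r₃ (by omega) le_rfl).2
  have hy_p₄ := (hrun6 p₄ (by omega) le_rfl).2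
  have hy_r₄ := (hrun7 r₄ (by omega) le_rfl).2
  have hR4' := hR8 (r₄ + 1) le_rfl (by omega)
  have hW7 := hrun6 (r₃ + 1) le_rfl (by omega)
  have hB2 := hrun5 (p₃ + 1) le_rfl (by omega)
  have hW5 := hrun4 (r₂ + 1) le_rfl (by omega)
  simp only [Nat.sub_self, Nat.cast_zero, mul_zero, add_zero] at hR4' hW7 hB2 hW5
  have hrun5' := dduududu_plateau₁ hm hω hv hD hU h12 h23 h34 hr12 hr23 hr34 ht2 ht4 ht5 ht6 ht7 hp1 hR0 hP1x hP1y hhor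
  have hR3 := (hrun5' r₃ (by omega) le_rfl).1
  have hP3 := (hrun4 p₃ (by omega) le_rfl).1
  obtain rfl : e₄ = 1 := by
    rcases he4 with h | rfl
    · exact h
    exfalso
    rcases Nat.lt_or_ge (r₂ + r₃) (2 * p₃) with hlt | hge
    · -- the second wall run starts on a site of the first
      obtain ⟨hjx, hjy⟩ := hrun4 (2 * p₃ - r₃ + 1) (by omega) (by omega)
      have hc := hinj (hmem (2 * p₃ - r₃ + 1) (by omega)) (hmem (r₃ + 1) (by omega))
        (site_ext_tb (by rw [hW7.1]; omega) (by rw [hjy, hW7.2]))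
      omega
    · -- the first bump passes under the return site `ω r₂`
      obtain ⟨hjx, hjy⟩ := hrun5' (2 * p₃ - r₂) (by omega) (by omega)
      have hc := hinj (hmem (2 * p₃ - r₂) (by omega)) (hmem r₂ (by omega)) (site_ext_tb (by omega) (by rw [hjy, hy_r₂]))
      omega
  simpa only [one_mul] using hrun4

open Classical in
/-- Step 5 for `dduududu_slack_four_false`: at most ONE interior visit time is a near-renewal (namely the time `2`): a
near-renewal on a wall run or on the final run would be a wall-renewal time (`isWRen_of_profile`: by Steps 1–4 everything
later lies strictly to its right), and an initial-run visit time `t ≥ 4` is followed by the return of the walk to the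
column `2`.  OURS (routine).
[cite: MadrasSlade1993, §4.2, Definition 4.2.1 (p. 90), remark before (4.2.21) (p. 94); EntingJensen2009, §7.4.2, Fig. 7.10] -/
theorem dduududu_card_nearRenewal_le {k m : ℕ} (hm : m = 6 * k + 4) (hω : ω ∈ ipwb m) (hv : visits m ω = k)
    {p₁ p₂ p₃ p₄ r₁ r₂ r₃ r₄ : ℕ} (hD : stepsD m ω = {p₁, p₂, p₃, p₄}) (hU : stepsU m ω = {r₁, r₂, r₃, r₄}) (h12 : p₁ < p₂)
    (h23 : p₂ < p₃) (h34 : p₃ < p₄) (hr12 : r₁ < r₂) (hr23 : r₂ < r₃) (hr34 : r₃ < r₄) (ht2 : p₂ < r₁) (ht4 : r₂ < p₃)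
    (ht5 : p₃ < r₃) (ht6 : r₃ < p₄) (ht7 : p₄ < r₄) (hp1 : 1 ≤ p₁) (hR0 : ∀ i, i ≤ p₁ → ω i 0 = i ∧ ω i 1 = 0)
    (hP1x : ω (p₁ + 1) 0 = p₁) (hP1y : ω (p₁ + 1) 1 = -1)
    (hhor : ∀ i, i < m → i ∉ stepsD m ω → i ∉ stepsU m ω →
      ω (i + 1) 1 = ω i 1 ∧ (ω (i + 1) 0 = ω i 0 + 1 ∨ ω (i + 1) 0 = ω i 0 - 1)) :
    #(((wallTimes m ω).erase m).filter fun t => NearRenewal m ω t) ≤ 1 := by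
  classical
  obtain ⟨hpw, hn1, hirr⟩ := mem_ipwb.1 hω
  obtain ⟨hw, hb⟩ := mem_pwb.1 hpw
  obtain ⟨ha, -⟩ := mem_wbr.1 hw
  obtain ⟨hh, -, -⟩ := mem_archs.1 ha
  obtain ⟨hs, hhp⟩ := mem_hpw.1 hh
  obtain ⟨h0, -, hbw, hinj⟩ := mem_saws_iff.1 hs
  have hX0 : ω 0 0 = 0 := by rw [h0]; rfl
  have hb' : ∀ i, 1 ≤ i → i ≤ m → 0 < ω i 0 ∧ ω i 0 ≤ ω m 0 := fun i h1 h2 => by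
    have := hb i h1 h2; rwa [hX0] at this
  have hmem : ∀ i, i ≤ m → i ∈ {i | i ≤ m} := fun i hi => hi
  obtain ⟨e₁, e₂, e₃, e₄, e₅, e₆, e₇, -, -, -, he4, he5, he6, he7, hrun1, hrun2, hrun3, hrun4, hrun5, hrun6, hrun7, hR8, hN',
    -, -, hparc_r₂, hparc_p₃, hparc_r₃, hparc_p₄, hparc_r₄, -, -, hpos_r₂, hpos_p₃, hpos_r₃, hpos_p₄, hn_r₄⟩ :=
    dduududu4_runs hm hω hv hD hU h12 h23 h34 hr12 hr23 hr34 ht2 ht4 ht5 ht6 ht7 hp1 hR0 hP1x hP1y hhor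
  have hy_p₃ := (hrun4 p₃ (by omega) le_rfl).2
  have hy_r₂ := (hrun3 r₂ (by omega) le_rfl).2
  have hy_r₃ := (hrun5 r₃ (by omega) le_rfl).2
  have hy_p₄ := (hrun6 p₄ (by omega) le_rfl).2
  have hy_r₄ := (hrun7 r₄ (by omega) le_rfl).2
  have hR4' := hR8 (r₄ + 1) le_rfl (by omega)
  have hW7 := hrun6 (r₃ + 1) le_rfl (by omega)
  have hB2 := hrun5 (p₃ + 1) le_rfl (by omega)
  have hW5 := hrun4 (r₂ + 1) le_rfl (by omega)
  simp only [Nat.sub_self, Nat.cast_zero, mul_zero, add_zero] at hR4' hW7 hB2 hW5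
  have hrun7' := dduududu_plateau₂ hm hω hv hD hU h12 h23 h34 hr12 hr23 hr34 ht2 ht4 ht5 ht6 ht7 hp1 hR0 hP1x hP1y hhor
  have hrun6' := dduududu_wallRun₂ hm hω hv hD hU h12 h23 h34 hr12 hr23 hr34 ht2 ht4 ht5 ht6 ht7 hp1 hR0 hP1x hP1y hhor
  have hrun5' := dduududu_plateau₁ hm hω hv hD hU h12 h23 h34 hr12 hr23 hr34 ht2 ht4 ht5 ht6 ht7 hp1 hR0 hP1x hP1y hhor
  have hrun4' := dduududu_wallRun₁ hm hω hv hD hU h12 h23 h34 hr12 hr23 hr34 ht2 ht4 ht5 ht6 ht7 hp1 hR0 hP1x hP1y hhor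
  have hR7 := (hrun7' r₄ (by omega) le_rfl).1
  have hP4 := (hrun6' p₄ (by omega) le_rfl).1
  have hR3 := (hrun5' r₃ (by omega) le_rfl).1
  have hP3 := (hrun4' p₃ (by omega) le_rfl).1
  have htodd_p₃ : p₃ % 2 = 1 := by
    have := parity_apply hs (show p₃ ≤ m by omega); rw [hy_p₃] at this; omega
  have htodd_p₄ : p₄ % 2 = 1 := by
    have := parity_apply hs (show p₄ ≤ m by omega); rw [hy_p₄] at this; omega
  refine le_trans (Finset.card_le_card fun t ht => ?_) (Finset.card_singleton 2).le
  rw [Finset.mem_filter, Finset.mem_erase, wallTimes, Finset.mem_filter, Finset.mem_Icc] at ht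
  obtain ⟨⟨htm, ⟨ht1, htm'⟩, ht2, hy⟩, hR, hhead, htail⟩ := ht
  rw [Finset.mem_singleton]
  have htm'' : t < m := lt_of_le_of_ne htm' htm
  have hhead' : ∀ i, 1 ≤ i → i ≤ t → ω i 0 ≤ ω t 0 := fun i hi1 hi2 => by
    rcases Nat.lt_or_ge i t with hit | hit
    · have := hhead i hit; omega
    · rw [show i = t by omega]
  rcases Nat.lt_or_ge t (p₁ + 1) with h0 | h0
  · -- an initial-run visit `t ≥ 4` is not a near-renewal: the walk comes back to the column `2`
    by_contra hne
    have ht4 : 4 ≤ t := by omega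
    obtain ⟨i, him, hiL, hix⟩ := exists_left_step_onto hω (show 1 ≤ 2 by norm_num) (show 2 < m by omega) (by norm_num)
      (hR0 2 (by omega)).2 (by rw [(hR0 3 (by omega)).1, (hR0 2 (by omega)).1]; norm_num)
    have hip : p₁ ≤ i := by
      by_contra hlt
      have h1 := (hR0 (i + 1) (by omega)).1
      have h2 := (hR0 i (by omega)).1
      rw [h1, h2] at hiL
      push_cast at hiL
      omega
    have := htail (i + 1) (by omega) (by omega)
    rw [(hR0 t (by omega)).1, hix, (hR0 2 (by omega)).1] at this
    push_cast at this
    omega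
  exfalso
  rcases Nat.lt_or_ge t (p₂ + 1) with h1 | h1
  · have := (hrun1 t h0 (by omega)).2; omega
  rcases Nat.lt_or_ge t (r₁ + 1) with h2 | h2
  · have := (hrun2 t h1 (by omega)).2; omega
  rcases Nat.lt_or_ge t (r₂ + 1) with h3 | h3
  · have := (hrun3 t h2 (by omega)).2; omega
  rcases Nat.lt_or_ge t p₃ with h4 | h4
  · -- on the first wall run: a wall-renewal time
    refine hirr t ht1 htm'' (isWRen_of_profile hb htm' ht2 hy hhead' fun j hj1 hj2 => ?_)
    have hxt := (hrun4' t h3 (by omega)).1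
    rcases Nat.lt_or_ge j (p₃ + 1) with hj | hj
    · have := (hrun4' j (by omega) (by omega)).1; omega
    rcases Nat.lt_or_ge j (r₃ + 1) with hj₂ | hj₂
    · have := (hrun5' j hj (by omega)).1; omega
    rcases Nat.lt_or_ge j (p₄ + 1) with hj₃ | hj₃
    · have := (hrun6' j hj₂ (by omega)).1; omega
    rcases Nat.lt_or_ge j (r₄ + 1) with hj₄ | hj₄
    · have := (hrun7' j hj₃ (by omega)).1; omega
    · have := (hR8 j hj₄ hj2).1; omega
  rcases Nat.lt_or_ge t (p₃ + 1) with h4' | h4'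
  · -- `t = p₃` is a dive time
    rw [show t = p₃ by omega] at hR; have := (hrun5' (p₃ + 1) le_rfl (by omega)).1; omega
  rcases Nat.lt_or_ge t (r₃ + 1) with h5 | h5
  · have := (hrun5 t h4' (by omega)).2; omega
  rcases Nat.lt_or_ge t p₄ with h6 | h6
  · -- on the second wall run: a wall-renewal time
    refine hirr t ht1 htm'' (isWRen_of_profile hb htm' ht2 hy hhead' fun j hj1 hj2 => ?_)
    have hxt := (hrun6' t h5 (by omega)).1
    rcases Nat.lt_or_ge j (p₄ + 1) with hj | hj
    · have := (hrun6' j (by omega) (by omega)).1; omega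
    rcases Nat.lt_or_ge j (r₄ + 1) with hj' | hj'
    · have := (hrun7' j hj (by omega)).1; omega
    · have := (hR8 j hj' hj2).1; omega
  rcases Nat.lt_or_ge t (p₄ + 1) with h6' | h6'
  · -- `t = p₄` is a dive time
    rw [show t = p₄ by omega] at hR; have := (hrun7' (p₄ + 1) le_rfl (by omega)).1; omega
  rcases Nat.lt_or_ge t (r₄ + 1) with h7 | h7
  · have := (hrun7 t h6' (by omega)).2; omega
  · -- on the final wall run: a wall-renewal time
    refine hirr t ht1 htm'' (isWRen_of_profile hb htm' ht2 hy hhead' fun j hj1 hj2 => ?_)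
    have := (hR8 t h7 htm').1; have := (hR8 j (by omega) hj2).1; omega

open Classical in
/-- **The order `D D U U D U D U` does not occur at slack four.** For an irreducible positive wall bridge of length `6k + 4`
(`k ≥ 2`) with `k` visits and four down steps, in the vertical profile of `profile_of_card_stepsD_eq_four`, the order
`p₁ < p₂ < r₁ < r₂ < p₃ < r₃ < p₄ < r₄` of its down times `pᵢ` and up times `rᵢ` is impossible: by
`dduududu_card_nearRenewal_le` and `slack_four_counts` the span is `2k + 2`, but the hairpin's return column
`X_{r₂} ≥ p₁ + 2` and the visit count give `X_{r₂} = p₁ + p₃ + p₄ + 4 − r₃ − r₄ ≤ p₁`.  NEW, a-idea-1 lineage.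
[cite: MadrasSlade1993, §4.2, Definition 4.2.1 (p. 90), remark before (4.2.21) (p. 94); EntingJensen2009, §7.4.2, Fig. 7.10] -/
theorem dduududu_slack_four_false {k m : ℕ} (hk : 2 ≤ k) (hm : m = 6 * k + 4) (hω : ω ∈ ipwb m) (hv : visits m ω = k)
    (hcD : #(stepsD m ω) = 4) {p₁ p₂ p₃ p₄ r₁ r₂ r₃ r₄ : ℕ} (hD : stepsD m ω = {p₁, p₂, p₃, p₄})
    (hU : stepsU m ω = {r₁, r₂, r₃, r₄}) (h12 : p₁ < p₂)
    (h23 : p₂ < p₃) (h34 : p₃ < p₄) (hr12 : r₁ < r₂) (hr23 : r₂ < r₃) (hr34 : r₃ < r₄) (ht2 : p₂ < r₁) (ht4 : r₂ < p₃)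
    (ht5 : p₃ < r₃) (ht6 : r₃ < p₄) (ht7 : p₄ < r₄) (hp1 : 1 ≤ p₁) (hR0 : ∀ i, i ≤ p₁ → ω i 0 = i ∧ ω i 1 = 0)
    (hP1x : ω (p₁ + 1) 0 = p₁) (hP1y : ω (p₁ + 1) 1 = -1)
    (hhor : ∀ i, i < m → i ∉ stepsD m ω → i ∉ stepsU m ω →
      ω (i + 1) 1 = ω i 1 ∧ (ω (i + 1) 0 = ω i 0 + 1 ∨ ω (i + 1) 0 = ω i 0 - 1)) : False := by
  classical
  obtain ⟨hpw, hn1, hirr⟩ := mem_ipwb.1 hω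
  obtain ⟨hw, hb⟩ := mem_pwb.1 hpw
  obtain ⟨ha, -⟩ := mem_wbr.1 hw
  obtain ⟨hh, -, -⟩ := mem_archs.1 ha
  obtain ⟨hs, hhp⟩ := mem_hpw.1 hh
  obtain ⟨h0, -, hbw, hinj⟩ := mem_saws_iff.1 hs
  have hX0 : ω 0 0 = 0 := by rw [h0]; rfl
  have hb' : ∀ i, 1 ≤ i → i ≤ m → 0 < ω i 0 ∧ ω i 0 ≤ ω m 0 := fun i h1 h2 => by
    have := hb i h1 h2; rwa [hX0] at this
  have hmem : ∀ i, i ≤ m → i ∈ {i | i ≤ m} := fun i hi => hi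
  obtain ⟨e₁, e₂, e₃, e₄, e₅, e₆, e₇, -, -, -, he4, he5, he6, he7, hrun1, hrun2, hrun3, hrun4, hrun5, hrun6, hrun7, hR8, hN',
    -, -, hparc_r₂, hparc_p₃, hparc_r₃, hparc_p₄, hparc_r₄, -, -, hpos_r₂, hpos_p₃, hpos_r₃, hpos_p₄, hn_r₄⟩ :=
    dduududu4_runs hm hω hv hD hU h12 h23 h34 hr12 hr23 hr34 ht2 ht4 ht5 ht6 ht7 hp1 hR0 hP1x hP1y hhor
  have hy_p₃ := (hrun4 p₃ (by omega) le_rfl).2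
  have hy_r₂ := (hrun3 r₂ (by omega) le_rfl).2
  have hy_r₃ := (hrun5 r₃ (by omega) le_rfl).2
  have hy_p₄ := (hrun6 p₄ (by omega) le_rfl).2
  have hy_r₄ := (hrun7 r₄ (by omega) le_rfl).2
  have hR4' := hR8 (r₄ + 1) le_rfl (by omega)
  have hW7 := hrun6 (r₃ + 1) le_rfl (by omega)
  have hB2 := hrun5 (p₃ + 1) le_rfl (by omega)
  have hW5 := hrun4 (r₂ + 1) le_rfl (by omega)
  simp only [Nat.sub_self, Nat.cast_zero, mul_zero, add_zero] at hR4' hW7 hB2 hW5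
  have hrun7' := dduududu_plateau₂ hm hω hv hD hU h12 h23 h34 hr12 hr23 hr34 ht2 ht4 ht5 ht6 ht7 hp1 hR0 hP1x hP1y hhor
  have hrun6' := dduududu_wallRun₂ hm hω hv hD hU h12 h23 h34 hr12 hr23 hr34 ht2 ht4 ht5 ht6 ht7 hp1 hR0 hP1x hP1y hhor
  have hrun5' := dduududu_plateau₁ hm hω hv hD hU h12 h23 h34 hr12 hr23 hr34 ht2 ht4 ht5 ht6 ht7 hp1 hR0 hP1x hP1y hhor
  have hrun4' := dduududu_wallRun₁ hm hω hv hD hU h12 h23 h34 hr12 hr23 hr34 ht2 ht4 ht5 ht6 ht7 hp1 hR0 hP1x hP1y hhor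
  have hs_eq := dduududu4_visits hm hω hv hD hU h12 h23 h34 hr12 hr23 hr34 ht2 ht4 ht5 ht6 ht7 hp1 hR0 hP1x hP1y hhor
  have hE1 := dduududu_card_nearRenewal_le hm hω hv hD hU h12 h23 h34 hr12 hr23 hr34 ht2 ht4 ht5 ht6 ht7 hp1 hR0 hP1x hP1y hhor
  have hR7 := (hrun7' r₄ (by omega) le_rfl).1
  have hP4 := (hrun6' p₄ (by omega) le_rfl).1
  have hR3 := (hrun5' r₃ (by omega) le_rfl).1
  have hP3 := (hrun4' p₃ (by omega) le_rfl).1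
  -- the span is `2k + 2`
  obtain ⟨hX3, -, -, -, -, -, h6x, -, h4x⟩ := slack_four_counts hk hm hω hv
  have hX : ω m 0 = 2 * k + 2 := by
    rcases hX3 with h | h | h
    · exact h
    · have := ((h4x h).1 hcD).1; omega
    · have := (h6x h).1; omega
  -- the hairpin's return column `c = X_{r₂}` is a fresh odd wall column: `c ≥ p₁ + 2`
  obtain ⟨c, hc⟩ : ∃ c : ℕ, ω r₂ 0 = c := ⟨_, (Int.toNat_of_nonneg hpos_r₂.le).symm⟩
  have hpodd : p₁ % 2 = 1 := by
    obtain ⟨-, -, -, hpar⟩ := of_mem_stepsD_coord hbw (i := p₁) (by rw [hD]; simp)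
    rw [hP1x, hP1y] at hpar; omega
  have hc2 : (p₁ : ℤ) + 2 ≤ ω r₂ 0 := by
    by_contra hlt
    have hcp : c ≤ p₁ := by omega
    have := hinj (hmem (r₂ + 1) (by omega)) (hmem c (by omega))
      (site_ext_tb (by rw [hW5.1, (hR0 c hcp).1, hc]) (by rw [hW5.2, (hR0 c hcp).2]))
    omega
  -- the gaps `r₃ ≥ p₃ + 2`, `r₄ ≥ p₄ + 2` (an up step right after a down step would return to the dive site), and the count
  have hgap5 : p₃ + 2 ≤ r₃ := by
    by_contra h
    have h' : r₃ = p₃ + 1 := by omega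
    have := hinj (hmem (r₃ + 1) (by omega)) (hmem p₃ (by omega))
      (site_ext_tb (by rw [hW7.1, hR3, h']; simp) (by rw [hW7.2, hy_p₃]))
    omega
  have hgap7 : p₄ + 2 ≤ r₄ := by
    by_contra h
    have h' : r₄ = p₄ + 1 := by omega
    have := hinj (hmem (r₄ + 1) (by omega)) (hmem p₄ (by omega))
      (site_ext_tb (by rw [hR4'.1, hR7, h']; simp) (by rw [hR4'.2, hy_p₄]))
    omega
  omega

end Literature.Probability.RandomPlanarGeometry.SAW.HexBW.Wall
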